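import Summits.CriticalPhenomena.SAWScalingLimit.Theses.SAWDefectDecoherence
import Summits.CriticalPhenomena.SAWScalingLimit.Theorems.SAWDefectDecoherenceBoundaryClosureREquivalence
import Summits.CriticalPhenomena.SAWScalingLimit.Theorems.SAWDefectDecoherenceBoundaryClosureRStarDefect
import Summits.CriticalPhenomena.SAWScalingLimit.Theorems.SAWDefectDecoherenceBoundaryClosureRLocalL1StarInversion
import Summits.CriticalPhenomena.SAWScalingLimit.Theorems.SAWDefectDecoherenceBoundaryClosureRPickEngineStarRegrouping
import Summits.CriticalPhenomena.SAWScalingLimit.Theorems.SAWDefectDecoherenceBoundaryClosureRLocalL1Poincare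
import HarnessLib.Audit

/-!
# Crux `BoundaryClosureR` (stmt-CriticalPhenomena-14004) — line `meso-cauchy-poincare`
# (strategist, 2026-08-17): the local `L¹` law splits at the MESOSCOPIC scale

STATE OF THE CRUX (certificate `Theorems/…BoundaryClosureREquivalence.lean`, p122667):
`BoundaryClosureR ↔ (DefectDecoherence → MassRatio → [I] LocalL1Root ∧ [II] GateTraceH)`, both
inputs NECESSARY for the target; every earlier line (pick-half-plane r15, dressed-arrival-cauchy-
transform, runge-gated-green-pairing, two-root-quotient) registers `[I]` (or a superset) as a raw
input and brings no engine for it (lead c5, `Lines/*-dead.md`).  The diagnosis file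
`Theorems/…LocalL1StarInversion.lean` records WHY: with DCS Lemma 1 (`U(v) = 0`) the star values are
`F({v,w}) = S(v)/3 + 4 m_w T(v)`, the DEFECT part `δ²Σ‖T‖` is `O(δ^{θ-3/4})‖F(b)‖` by
`DefectDecoherence` + `MassRatio`, and the SIGNAL part `δ²Σ‖S‖` "is the observable itself, with no
cancellation offered by the vertex relation".

THIS LINE'S ENGINE (new for [I]; the other input [II] is kept verbatim as a registered model
input): the vertex relation DOES constrain the signal — not its size but its VARIATION.  By the
landed star identity (`StarDefect.star_identity`, `norm_edge_sub_edge_succ_le_of_relations`)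
consecutive edge values around every vertex / hexagon differ by at most twice the conjugated star
defect: the signal `A(v) = S(v)/3` is a lattice function whose DISCRETE GRADIENT is the defect
channel `B(v) ∝ T(v)`, which `DefectDecoherence` bounds by `C R^{-θ}·(star mass)` at depth `R`.
Two consequences, together the registered provable stub `stub_mesoToLocal`:

* (Poincaré form) on a lattice box of side `R` the `L¹`-oscillation of `A` about its box mean is
  `≤ C R · Σ_box ‖T‖` (`LocalL1Poincare.box_poincare_mean`, landed generic lemma), hence
  `δ² Σ_K ‖A − Ā_R‖ ≤ C R δ^{θ-3/4} ‖F(b_δ)‖` by DD at depth `d/δ` and MR;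
* (Cauchy–Pompeiu form, sharper) pairing the weighted regrouping identity
  (`Engine.pickEngine_starRegrouping`, landed, any weight) with the COMPACTLY SUPPORTED weight
  `G_z = 1/(· − z) − (1/(· − z) ∗ η_R)` (zero outside the lattice ball `B_R(z)` by the mean-value
  property of `1/w`) gives the exact local identity `n₀·F(e₀) = π(3ℓ²/4)·Ā_R(z) + O(Σ_{B_R}
  ‖T(v)‖ |v−z|^{-2}) + O(A log A · max_{B_A(z)} ‖B‖) + O((A^{-1} + R^{-1}) · Σ_{B_R} ‖F‖ |v−z|^{-3})`
  (`n₀ = 3πℓ²ρ_V/4 ≠ 0` a lattice constant; `A` a large lattice constant), whose `T`-terms cost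
  only `log R · δ²Σ‖T‖ = O(log R · δ^{θ-3/4})‖F(b)‖` and whose last term is ABSORBED (slowly varying
  cut-off weight; leakage `O(R δ^{1/4})` relative, by `MassRatio`).
Hence for the mesoscopic radius `R(δ) = δ^{-1/8}` (any `δ^{-β}`, `0 < β < 1/4`, works):

  `[I] LocalL1Root  ⇐  DefectDecoherence ∧ MassRatio ∧ MesoL1Law`,

where `MesoL1Law` is `[I]` for the observable AVERAGED over lattice balls of radius `δ^{-1/8}`:
sub-mesoscopic `L¹` concentration is impossible given the route's own exponent cruxes.  What is
left of `[I]` is a statement about the functionals `N_δ` on mesoscopic bumps — the currency of the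
pool's boundary engines (Cauchy transform of the dressed arrival measure: tame carriers only, see
the census) and of any future scale-recursion for the signal channel.  `MesoL1Law` is NECESSARY
(averaging contracts `L¹`: `[I] ⇒ MesoL1Law`, double counting) and strictly weaker than `[I]` only
by the lattice-to-mesoscopic content this line proves.

REGISTERED STUBS (3): `stub_mesoToLocal` (PROVABLE, L: the engine above), `stub_mesoL1Law`
(MODEL INPUT, necessary, OPEN), `stub_gateTraceH` (MODEL INPUT [II], necessary, OPEN — no engine
here; see line `polygon-parity-squeeze`).  Composition `BoundaryClosureR_of` = the landed
`Equivalence.target_of_inputs`.  Disproof used: §0 (no ex-falso use of ¬DD/¬MR), §1 both pins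
honoured (the frame is the target's, verbatim `AdmissibleFamily`/`PinnedFlatRoot` at `pt 0`); no
stub is an instance of a landed Negative lemma (NormaliserPin/RootPin refute pin DELETIONS; all
statements here keep both pins).  Census: `Cruxes/BoundaryClosureR/STRATEGY-CENSUS.md`.
-/

noncomputable section

open scoped BigOperators ComplexConjugate Topology Classical
open Filter Set MeasureTheory
open Literature.Probability.LatticeModels Literature.Probability.RandomPlanarGeometry
open Literature.Probability.RandomPlanarGeometry.SAW
open Summit.CriticalPhenomena.SAWScalingLimit.Theses.SAWDefectDecoherence

namespace Summit.CriticalPhenomena.SAWScalingLimit.Cruxes.BoundaryClosureR.MesoCauchyPoincare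

/-! ### 1. Vocabulary (verbatim copies of the r15 skeleton `Lines/pick_half_plane.lean`) -/

/-- The normalised functional `N^{e}_δ(ψ) := δ² Σ_{z ∈ Ω_δ} ψ(δ·mid z) F^{e δ}(z) / F^{e δ}(b δ)`
(root family `e`, normalisation family `b`, spin `5/8`, fugacity `x_c`). -/
def NF (Λ : ℝ → Finset HexVertex) (e b : ℝ → Sym2 HexVertex) (δ : ℝ) (ψ : ℂ → ℂ) : ℂ :=
  (δ : ℂ) ^ 2 * (∑ᶠ z ∈ hexDomainMidEdges (Λ δ),
      ψ ((δ : ℂ) * hexMidpoint z) * hexParafermionicObservable (Λ δ) (e δ) hexCriticalFugacity (5 / 8) z) /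
    hexParafermionicObservable (Λ δ) (e δ) hexCriticalFugacity (5 / 8) (b δ)

/-- Bulk test functions of the target: continuous, compactly supported inside the domain. -/
def IsTest (D : DobrushinDomain) (ψ : ℂ → ℂ) : Prop :=
  Continuous ψ ∧ HasCompactSupport ψ ∧ tsupport ψ ⊆ D.carrier

/-- The root-free part of the target's hypotheses: flat piece and exact half-lattice around the
normalisation point `D.pt 1`, eventual admissibility of `Λ δ`, exhaustion of compacts, `b δ → pt 1`.
(Verbatim `TwoRootQuotient.AdmissibleFamily`.) -/
def AdmissibleFamily (D : DobrushinDomain) (ρ : ℝ) (Λ : ℝ → Finset HexVertex) (m : ℝ → ℤ)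
    (b : ℝ → Sym2 HexVertex) : Prop :=
  0 < ρ ∧
  D.carrier ∩ Metric.ball (D.pt 1) ρ = {z : ℂ | (D.pt 1).im < z.im} ∩ Metric.ball (D.pt 1) ρ ∧
  (∀ᶠ δ : ℝ in 𝓝[>] 0, hexDomainSimplyConnected (Λ δ) ∧ b δ ∈ hexDomainBoundary (Λ δ) ∧
      (hexGraph.induce ((Λ δ : Finset HexVertex) : Set HexVertex)).Preconnected ∧
      (∀ v ∈ Λ δ, (δ : ℂ) * hexCenter v ∈ D.carrier) ∧
      (∀ v : HexVertex, (δ : ℂ) * hexCenter v ∈ Metric.ball (D.pt 1) ρ → (v ∈ Λ δ ↔ m δ ≤ v.1 1))) ∧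
  (∀ K : Set ℂ, IsCompact K → K ⊆ D.carrier →
      ∀ᶠ δ : ℝ in 𝓝[>] 0, ∀ v : HexVertex, (δ : ℂ) * hexCenter v ∈ K → v ∈ Λ δ) ∧
  Tendsto (fun δ : ℝ => (δ : ℂ) * hexMidpoint (b δ)) (𝓝[>] 0) (𝓝 (D.pt 1))

/-- A root family `e` PINNED on a flat piece at `x ∈ ∂D`: inside `ball x r` the domain is the open
half-plane above `x` and `Λ δ` is exactly the half-lattice `{v | mr δ ≤ v.1 1}`; the roots are
boundary mid-edges with `δ·mid(e δ) → x`, and walks to the normaliser exist.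
(Verbatim `TwoRootQuotient.PinnedFlatRoot`.) -/
def PinnedFlatRoot (D : DobrushinDomain) (Λ : ℝ → Finset HexVertex) (b : ℝ → Sym2 HexVertex)
    (x : ℂ) (e : ℝ → Sym2 HexVertex) (r : ℝ) (mr : ℝ → ℤ) : Prop :=
  0 < r ∧
  D.carrier ∩ Metric.ball x r = {z : ℂ | x.im < z.im} ∩ Metric.ball x r ∧
  (∀ᶠ δ : ℝ in 𝓝[>] 0, e δ ∈ hexDomainBoundary (Λ δ) ∧ Nonempty (HexMidEdgeSAW (Λ δ) (e δ) (b δ)) ∧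
      (∀ v : HexVertex, (δ : ℂ) * hexCenter v ∈ Metric.ball x r → (v ∈ Λ δ ↔ mr δ ≤ v.1 1))) ∧
  Tendsto (fun δ : ℝ => (δ : ℂ) * hexMidpoint (e δ)) (𝓝[>] 0) (𝓝 x)

/-- `g` is the weak limit of the normalised functionals of root family `e` along the mesh sequence
`ns`: `N^{e}_{ns n}(ψ) → ∫ ψ g` for every bulk test function. (Verbatim `TwoRootQuotient.IsWeakLimit`.) -/
def IsWeakLimit (D : DobrushinDomain) (Λ : ℝ → Finset HexVertex) (e b : ℝ → Sym2 HexVertex)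
    (ns : ℕ → ℝ) (g : ℂ → ℂ) : Prop :=
  ∀ ψ : ℂ → ℂ, IsTest D ψ → Tendsto (fun n => NF Λ e b (ns n) ψ) atTop (𝓝 (∫ z, ψ z * g z))

/-- The two marked points of a Dobrushin domain are distinct. [folklore] -/
theorem pt_zero_ne_one (D : DobrushinDomain) : D.pt 0 ≠ D.pt 1 :=
  fun h => absurd (D.pt_injective h) (by decide)

/-- **LOCAL `L¹` LAW AT THE TARGET'S ROOT** (r15 registered MODEL INPUT 1/2): `LocalL1Bound` asked only
for the root family pinned at `D.pt 0` — on every compact of the carrier the `b`-normalised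
observable of the target's own root has eventually bounded `L¹` mass,
`δ² Σ_{δ·mid z ∈ K} |F_δ(z)| ≤ C_K |F_δ(b δ)|`.  NECESSARY for the target (Banach–Steinhaus on
`C(K)`, landed `LocalL1.stub_localL1Bound_necessity` p88459, given an admissible conformal datum —
`stub_localL1Root_necessity`); it is the `δ^{25/48}` phase cancellation of the parafermionic
observable in AVERAGED form (the masses `Z ≥ |F|` have `δ²Σ_K Z/Z(b δ) ≍ δ^{-25/48}`), i.e. the
"no concentration" half of Conjecture 2's existence statement; OPEN. -/
def LocalL1Root : Prop :=
  ∀ (D : DobrushinDomain) (ρ : ℝ) (Λ : ℝ → Finset HexVertex) (m : ℝ → ℤ) (b : ℝ → Sym2 HexVertex),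
    AdmissibleFamily D ρ Λ m b →
  ∀ (a : ℝ → Sym2 HexVertex) (r₀ : ℝ) (m₀ : ℝ → ℤ), PinnedFlatRoot D Λ b (D.pt 0) a r₀ m₀ →
  ∀ K : Set ℂ, IsCompact K → K ⊆ D.carrier → ∃ C : ℝ, ∀ᶠ δ : ℝ in 𝓝[>] 0,
    δ ^ 2 * (∑ᶠ z ∈ {z : Sym2 HexVertex | z ∈ hexDomainMidEdges (Λ δ) ∧ (δ : ℂ) * hexMidpoint z ∈ K},
        ‖hexParafermionicObservable (Λ δ) (a δ) hexCriticalFugacity (5 / 8) z‖) ≤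
      C * ‖hexParafermionicObservable (Λ δ) (a δ) hexCriticalFugacity (5 / 8) (b δ)‖

/-- **GATE TRACE OF HOLOMORPHIC WEAK LIMITS** (r15 registered MODEL INPUT 2/2): `GateTrace` with the
Pick–cup clauses of the limit DROPPED — ONE universal `c ≠ 0` such that for every admissible datum,
root pinned at `D.pt 0`, admissible conformal datum `(Φ, L, L_b)`, mesh sequence `ns` and every
function `g` HOLOMORPHIC on the carrier that is the weak limit of the normalised functionals along
`ns`, `g · exp(−(5/8)(L − L_b)) → c` within the carrier at every point of the flat gate
`{im = im (pt 1)} ∩ B(pt 1, ρ)`.  NECESSARY for the target (`stub_gateTraceH_necessity`: the target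
forces `g = c·exp((5/8)(L − L_b))` on the carrier by uniqueness of weak limits); together with
`LocalL1Root` (and DD, MR) SUFFICIENT (`BoundaryClosureR_of`).  By the landed identity-theorem glue it
is the ENTIRE identification content of DCS Conjecture 2 for subsequential limits (Riemann–Hilbert
data on all of `∂Ω`, or the two-root quotient); positive-mass currency: `GateMassProfile` of
`Cruxes/BoundaryClosureR/PROMOTE-c2.md` §2(4).  OPEN (conjecture strength). -/
def GateTraceH : Prop :=
  ∃ c : ℂ, c ≠ 0 ∧
    ∀ (D : DobrushinDomain) (ρ : ℝ) (Λ : ℝ → Finset HexVertex) (m : ℝ → ℤ) (b : ℝ → Sym2 HexVertex),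
      AdmissibleFamily D ρ Λ m b →
    ∀ (a : ℝ → Sym2 HexVertex) (r₀ : ℝ) (m₀ : ℝ → ℤ), PinnedFlatRoot D Λ b (D.pt 0) a r₀ m₀ →
    ∀ (Φ : ConformalEquiv D.carrier UpperHalfPlane.upperHalfPlaneSet) (L : ℂ → ℂ) (Lb : ℂ),
      Tendsto (fun z => ‖Φ z‖) (𝓝[D.carrier] (D.pt 0)) atTop → Φ.HasBoundaryValue (D.pt 1) 0 →
      ContinuousOn L D.carrier → (∀ z ∈ D.carrier, Complex.exp (L z) = deriv Φ z) →
      Tendsto L (𝓝[D.carrier] (D.pt 1)) (𝓝 Lb) →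
    ∀ ns : ℕ → ℝ, Tendsto ns atTop (𝓝[>] 0) →
    ∀ g : ℂ → ℂ, DifferentiableOn ℂ g D.carrier → IsWeakLimit D Λ a b ns g →
      ∀ y : ℂ, y.im = (D.pt 1).im → y ∈ Metric.ball (D.pt 1) ρ →
        Tendsto (fun z => g z * Complex.exp (-((5 / 8 : ℂ) * (L z - Lb)))) (𝓝[D.carrier] y) (𝓝 c)


/-! ### 2. The new statement of this line -/

/-- The MESOSCOPIC RADIUS schedule of the line, in lattice units: `R(δ) = δ^{-1/8}` (any exponent in
`(0, 1/4)` would do: the absorption step leaks `O(R δ^{1/4})` relative mass by `MassRatio`). -/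
def mesoRadius (δ : ℝ) : ℝ := δ ^ (-(1 / 8 : ℝ))

/-- **MESOSCOPIC `L¹` LAW AT THE ROOT** (registered MODEL INPUT `stub_mesoL1Law`): the local `L¹`
law `[I]` for the observable AVERAGED over lattice balls of the mesoscopic radius `R(δ) = δ^{-1/8}`.
In the frame of `LocalL1Root` (admissible family, root pinned at `pt 0`), for every compact `K` of
the carrier there is `C` with, eventually as `δ → 0+`,
`δ² Σ_{v ∈ Λ_δ, δc_v ∈ K} ‖ R(δ)^{-2} Σ_{z ∈ Ω_δ, |mid z − c_v| ≤ R(δ)} F_δ(z) ‖ ≤ C ‖F_δ(b_δ)‖`.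
NECESSARY for `[I]` (hence for the target): averaging contracts `L¹` (each mid-edge lies in `O(R²)`
balls; the `R δ`-thickening of `K` is a compact of the carrier eventually).  Content: the
`δ^{25/48}` phase cancellation of the signal channel at scales ABOVE `δ^{7/8}` only; engines: the
Cauchy transform of the dressed boundary arrival measure (card dressed-arrival-cauchy-transform,
item 2 — valid on TAME carriers, false-risk on free mesoscopically rough collars, see census), or a
scale recursion for ball averages.  OPEN. -/
def MesoL1Law : Prop :=
  ∀ (D : DobrushinDomain) (ρ : ℝ) (Λ : ℝ → Finset HexVertex) (m : ℝ → ℤ) (b : ℝ → Sym2 HexVertex),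
    AdmissibleFamily D ρ Λ m b →
  ∀ (a : ℝ → Sym2 HexVertex) (r₀ : ℝ) (m₀ : ℝ → ℤ), PinnedFlatRoot D Λ b (D.pt 0) a r₀ m₀ →
  ∀ K : Set ℂ, IsCompact K → K ⊆ D.carrier → ∃ C : ℝ, ∀ᶠ δ : ℝ in 𝓝[>] 0,
    δ ^ 2 * (∑ᶠ v ∈ {v : HexVertex | v ∈ Λ δ ∧ (δ : ℂ) * hexCenter v ∈ K},
        ‖(∑ᶠ z ∈ {z : Sym2 HexVertex | z ∈ hexDomainMidEdges (Λ δ) ∧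
              dist (hexMidpoint z) (hexCenter v) ≤ mesoRadius δ},
            hexParafermionicObservable (Λ δ) (a δ) hexCriticalFugacity (5 / 8) z) /
          ((mesoRadius δ ^ 2 : ℝ) : ℂ)‖) ≤
      C * ‖hexParafermionicObservable (Λ δ) (a δ) hexCriticalFugacity (5 / 8) (b δ)‖

/-! ### 3. The registered stubs (the only `sorry`s of the file) -/

/-- STUB 1 (PROVABLE, size L; THE ENGINE): **mesoscopic-to-local reduction of the `L¹` law.**
Given the mesoscopic law, `DefectDecoherence` and `MassRatio` imply `[I]`:
(a) star inversion (`LocalL1StarInversion`): `‖F({v,w})‖ ≤ ‖S(v)‖/3 + 2‖T(v)‖`, so it suffices to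
bound `δ²Σ_K ‖S‖` (the `T`-part is `O(δ^{θ−3/4})‖F(b)‖`);
(b) discrete gradient: `star_identity` ⇒ `‖A(v) − A(v')‖ ≤ C(‖T(v)‖ + ‖T(v')‖)` for adjacent `v, v'`
(`A = S/3`), i.e. `T` is the discrete gradient of the signal;
(c) EITHER box Poincaré (`LocalL1Poincare.box_poincare_mean` on boxes of side `R = δ^{-1/8}`:
`Σ_box ‖A − mean‖ ≤ C R Σ_box ‖T‖`, total `O(R δ^{θ−3/4}) = O(δ^{θ−7/8})` — enough when `θ > 7/8`)
OR, at the route's cut `θ > 3/4`, the compactly supported Cauchy–Pompeiu identity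
(`Engine.pickEngine_starRegrouping` with weight `1/(·−z) − 1/(·−z) ∗ η_R`, zero off `B_R(z)`):
`T` enters through `∂G ∼ |v−z|^{-2}` (cost `log R · δ²Σ‖T‖`), the mean through `∂̄G = −πη_R`,
the value `F(e₀)` through the exact near zone (`n₀ = N_A[1] ≠ 0` by the same identity for the
constant solution `F ≡ 1` of the vertex relation), the rest is `O(A^{-1} + R^{-1})·Σ_{B_R}‖F‖|v−z|^{-3}`;
(d) absorption of the last term with a cut-off weight varying on scale `d` (leakage
`O(R δ · δ^{-3/4}/d)` relative by `MassRatio`, `→ 0` for `R = δ^{-1/8}`); the surviving main term is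
`MesoL1Law` on the `Rδ`-thickening of `K`.  [folklore; Duminil-Copin–Smirnov 2012 §3 (summation by
parts); Chelkak–Smirnov arXiv:0810.2188 (discrete Cauchy kernels, for orientation only)] -/
theorem stub_mesoToLocal : MesoL1Law → DefectDecoherence → MassRatio → LocalL1Root := by
  sorry

/-- STUB 2 (MODEL INPUT, necessary for the target, OPEN): the mesoscopic `L¹` law. -/
theorem stub_mesoL1Law : MesoL1Law := by
  sorry

/-- STUB 3 (MODEL INPUT [II], necessary for the target, OPEN; verbatim the r15 `stub_gateTraceH`):
the gate trace of holomorphic weak limits.  No engine in THIS line (see `polygon-parity-squeeze`). -/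
theorem stub_gateTraceH : GateTraceH := by
  sorry

/-! ### Name-keyed aliases of the stub statements (hypotheses of the composition) -/
namespace Registered

/-- statement of `stub_mesoToLocal` -/
abbrev stub_mesoToLocal : Prop := MesoL1Law → DefectDecoherence → MassRatio → LocalL1Root

/-- statement of `stub_mesoL1Law` -/
abbrev stub_mesoL1Law : Prop := MesoL1Law

/-- statement of `stub_gateTraceH` -/
abbrev stub_gateTraceH : Prop := GateTraceH

end Registered

/-! ### 4. The composition (kernel-checked, no `sorry`) -/

/-- **The crux from the three registered stubs**: `MesoL1Law` + the reduction give `[I]`; with `[II]`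
the landed certificate `Equivalence.target_of_inputs` (exponent cruxes ⇒ CCN ⇒ holomorphic weak
limits ⇒ identification ⇒ subsequence principle) yields `HexObservableLimitR`, i.e.
`BoundaryClosureR` BY NAME. -/
theorem BoundaryClosureR_of
    (h1 : Registered.stub_mesoToLocal) (h2 : Registered.stub_mesoL1Law) (h3 : Registered.stub_gateTraceH) :
    Summit.CriticalPhenomena.SAWScalingLimit.Theses.SAWDefectDecoherence.BoundaryClosureR :=
  fun hDD hMR =>
    Summit.CriticalPhenomena.SAWScalingLimit.Theorems.PickHalfPlane.Equivalence.target_of_inputs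
      hDD hMR (h1 h2 hDD hMR) h3

end Summit.CriticalPhenomena.SAWScalingLimit.Cruxes.BoundaryClosureR.MesoCauchyPoincare

end
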